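import Literature.MathematicalPhysics.QuantumFieldTheory.Balaban1983to89.B9PerturbationMajorantAlgebra
import Literature.MathematicalPhysics.QuantumFieldTheory.Balaban1983to89.B9Thm312WholeL2

/-!
# `Balaban1983to89.B9Thm313WholeQstarFromG0` — [B9] Theorems 3.12–3.13 (pp. 420–426): THE Q\*-COMPOSITES OF THE SECT.-D LETTERS OF ROWS
# 20–21 (G₀Q\*, ∇_UG₀Q\*, ∇_{U,ν}G₀Q\*, ζ∇_UG₀Q\*, ζ∇_{U,ν}G₀Q\*, ζG₀Q\*; sup, Hölder-probe and block-L² forms) ARE THEOREM 3.3 FOR G₀ COMPOSED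
# WITH ONE KINEMATIC LETTER OF THE AVERAGING ADJOINT Q\* — eleven displayed letter fields become theorems of rows 19's derived material

T. Bałaban, *Propagators for lattice gauge theories in a background field*, Commun. Math. Phys. **99** (1985) 389–434
[`Balaban1985BackgroundPropagators`, "B9"]; [4] = T. Bałaban, *Propagators and renormalization transformations for lattice gauge
theories. II*, Commun. Math. Phys. **96** (1984) 223–250 [`Balaban1984PropagatorsII`].

statement-level skeleton of published theorems with citation tags; proofs where landed; nothing here is a claim about the Yang–Mills
mass gap

THE PRINTED LOCUS (held text `paper:balaban1985-cmp99-background-propagators`).  (3.126) p. 420: *"HB = GQ\*(QGQ\*)⁻¹B"*; (3.129) p. 421: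
*"H₁B = G₁Q\*(QG₁Q\*)⁻¹B"*; (3.153) p. 426: *"𝔊 = G₁ − G₁DRD\*G₁ − G₁Q\*(QG₁Q\*)⁻¹QG₁"*; p. 422: *"The operators (QGQ\*)⁻¹, or (QG₁Q\*)⁻¹, can be
analyzed in the same way as the operator (Q′G′²Q′\*)⁻¹ … The above inequality together with Theorem 3.3 for G … give (3.133)"*; (3.110) p. 417
(the averaging operator Q); Theorem 3.3 p. 399 with (3.42)–(3.46) pp. 397–398; p. 398 (remark after (3.47): *"we may replace the factor (Lʲη)^α by
(Lʲη)^β(L^{j′}η)^γ with β + γ = α"*); [4] (2.52)–(2.56), Lemma 2.1 (2.60)–(2.61).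

THE POINT.  The rows-20–21 leaves display, among the Sect.-D letters of (3.126)∕(3.129)∕(3.133)∕(3.153), the composites of G₀ = G(U) with the
adjoint Q\* of the averaging operator: `LettersHZ.gQs2 ∕ dgQs`, `LettersHHZ.pQ`, `Letters313Z.gQs2 ∕ gQs1`, `Letters313DZ.dgQs`,
`Letters313DMZ.dgQsd ∕ pQd`, `Letters313HZ.pXQs` (sup and Hölder-probe classes) and `Letters313L2PZ.gQs ∕ dGQs ∕ ddGQs`, `Letters313L2MZ.dGQsd`
(block-L²).  In print each is Theorem 3.3 for G₀ ((3.42)₁,₂, (3.43)₁, (3.46)₀,₁,₄ — available at the record as rows 19's DERIVED material: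
`B9Thm312WholeFromThm310.thm33G0_of_conv3107`, `…thm33G0Dir_of_conv3107`, `B9Thm312WholeFromThm310L2.thm33G0L2M_of_conv3107`) followed by the
averaging adjoint Q\*, an explicit block-local operator of (3.110) whose only property used is a KINEMATIC majorant — `hqs` (sup classes:
Q\* maps the coarse class `bZ` into the sharp bond blocks 𝔠⁽⁰⁾ with B_Q·e^{−δ_Qd}) resp. `hqsL2` (block-L²: ‖1_{Δ(y)}Q\*B‖₂ ≦ B_Q(Lʲη)⁻¹(v_Z·L^{j′}η)(y′)
e^{−δ_Qd(y,y′)}‖B‖₂; at the record Q\* is block-DIAGONAL, so any δ_Q serves).  THIS FILE types the compositions ([4] (2.52)–(2.56) with Lemma 2.1's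
row sum spent on the Q\*-letter, so that no rate is lost on G₀; one scale transfer (2.60) for the two letters whose source carries an extra Lʲη):
* §1 the sup letters: `gQs2_of_e0` (G₀Q\* : bZ → 𝔠⁽²⁾), `dgQs_of_e1` (E∘G₀∘Q\* : bZ → 𝔠_V⁽¹⁾ for any first-order left letter E — ∇_U, ∇_{U,ν}),
  `gQs1_of_e0` (G₀Q\* : Z_{len·w} → 𝔠⁽¹⁾, one transfer);
* §2 the Hölder-probe letters: `pQ_of_h43` (Φ_β∘E∘G₀∘Q\* : bZ → 𝔠_P^{(β−1)} from a (3.43)-shape probe majorant — `LettersHHZ.pQ`, `Letters313DMZ.pQd`),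
  `pXQs_of_pX0` (Φ^X_β∘G₀∘Q\* : Z_{len·w} → 𝔠_P^{(β−1)} from the zeroth-order probe `Thm33G0DirX.pX0`, one transfer);
* §3 the block-L² letters: `blockBd_comp_qstar` (generic A∘Q\* from a (3.46)-line of A with input scale L^{j′}η) and its three readings `gQs_l2_of_l0`,
  `dGQs_l2_of_l1` (also the per-direction `dGQsd`), `ddGQs_l2_of_l3`.

HONEST SCOPE.  Kernel bookkeeping over landed modules: eleven displayed ANALYTIC letter fields of rows 20–21 become theorems of rows 19's
derived Theorem-3.3-for-G₀ schemas (`Thm33G0`, `LeftStep.e1`, `Thm33G0Dir`, `Thm33G0L2M`), of the displayed `Thm33G0DirX.pX0` (for `pXQs` only),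
and of TWO KINEMATIC letters of Q\* (`hqs`, `hqsL2` — dischargeable at def-Y's `QscoKH` by the knit; NOT asserted here).  Nothing of print's
estimates is asserted.  COUNT-NEUTRAL; N06 NOT discharged; one finite lattice at a time; nothing continuum, nothing about the mass gap.  Cell
`pub-ymgap` (HUMAN RULING D-0062), Track A node N06 [B9], N06-ASSIGNMENT v1 rows 20–21 (bundle F7), seat `pub-ymgap-dag-n06-l` (g16), 2026-08-28.
-/

namespace Literature.MathematicalPhysics.QuantumFieldTheory.Balaban1983to89.B9Thm313WholeQstarFromG0

open Literature.MathematicalPhysics.QuantumFieldTheory.Balaban1983to89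
open Finset B6RandomWalk B6RandomWalkHom B9Thm34Ext B11SectG B9SectDSup B9SectDL2Decay B9Thm37Glue B9Thm312Whole
open B9Thm312WholeClasses B9RWSums343to347Whole B9RWSums346Schur B9PerturbationMajorantAlgebra

noncomputable section

variable {g : B9.Geometry} {B : B9.Backgrounds} {X V Z PX : Type} [Fintype X] [Fintype V] [Fintype Z] [Fintype PX] [Fintype g.Site]
variable {R₀ : ℝ} {H₀ : Prop}

/-! ## §0 Conversions -/

omit [Fintype V] [Fintype PX] in
/-- A majorant into the integer-weight class `cNorm … 0` is a majorant into 𝔠^{(0)} (real weight). [cite: Balaban1985BackgroundPropagators, (3.42) p.397 (bookkeeping)] -/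
theorem hasMaj_toR_out0 (hG : GeoOK g) {F : Type} [AddCommGroup F] [Module ℝ F] {b : BlockNorm (toB6 g R₀ H₀) F} {blk : X → g.Site}
    {T : F →ₗ[ℝ] (X → ℝ)} {K : g.Site → g.Site → ℝ} (h : HasMaj b (cNorm R₀ H₀ blk hG.lenle 0) T K) :
    HasMaj b (cNormR R₀ H₀ blk hG.lenle 0) T K := by
  intro y' μ hμ y
  have e : (cNormR R₀ H₀ blk hG.lenle 0).loc y (T μ) = (cNorm R₀ H₀ blk hG.lenle 0).loc y (T μ) := by
    have h0 := cNormR_loc_neg_natCast (R₀ := R₀) (H₀ := H₀) hG blk 0 y (T μ)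
    simpa only [Nat.cast_zero, neg_zero] using h0
  rw [e]
  exact h y' μ hμ y

omit [Fintype V] [Fintype PX] in
/-- **p. 398's TRANSFER FOR A WEIGHTED COARSE SOURCE**: a majorant C·e^{−rd} of T from the coarse class of weight w into 𝔠^{(s)} is the majorant
C·L₀·e^{−(r−αδ)d} from the class of weight Lʲη·w into 𝔠^{(s+1)} — the ratio Lʲη∕L^{j′}η costs L₀·e^{αδd} by [4] (2.60) in the form of the member
facts `Facts347` (the weighted-source twin of `B9PerturbationMajorantAlgebra.hasMaj_shift` at γ = 1). [cite: Balaban1985BackgroundPropagators, p.398 (remark after (3.47)); Balaban1984PropagatorsII, Lemma 2.1 (2.60) p.234] -/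
theorem hasMaj_shift_weight (hG : GeoOK g) {dF : ℕ} {δ α L₀ : ℝ} (hF : Facts347 g R₀ H₀ dF δ α L₀) {blkZ : Z → g.Site} {blk : X → g.Site}
    {w : g.Site → ℝ} (hw : ∀ y, 0 ≤ w y) (hw' : ∀ y, 0 ≤ g.len y * w y) {T : (Z → ℝ) →ₗ[ℝ] (X → ℝ)} {C r s : ℝ} (hC : 0 ≤ C)
    (h : HasMaj (weightNorm (BlockNorm.ofBlocks (toB6 g R₀ H₀) blkZ) w hw) (cNormR R₀ H₀ blk hG.lenle s) T
      (fun a b => C * Real.exp (-(r * g.dist a b)))) :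
    HasMaj (weightNorm (BlockNorm.ofBlocks (toB6 g R₀ H₀) blkZ) (fun y => g.len y * w y) hw') (cNormR R₀ H₀ blk hG.lenle (s + 1)) T
      (fun a b => C * L₀ * Real.exp (-((r - α * δ) * g.dist a b))) := by
  intro y' μ hμ y
  have hb := h y' μ hμ y
  rw [weightNorm_loc, cNormR_loc] at hb
  rw [weightNorm_loc, cNormR_loc, Real.rpow_add (hG.lenpos y), Real.rpow_one]
  set N := (BlockNorm.ofBlocks (toB6 g R₀ H₀) blk).loc y (T μ) with hN
  set N' := (BlockNorm.ofBlocks (toB6 g R₀ H₀) blkZ).loc y' μ with hN'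
  have hN'0 : 0 ≤ N' := (BlockNorm.ofBlocks (toB6 g R₀ H₀) blkZ).loc_nonneg y' μ
  have hwN : 0 ≤ w y' * N' := mul_nonneg (hw y') hN'0
  -- the transfer at (y′, y): e^{−αδd(y,y′)}·Lʲη ≦ L₀·L^{j′}η
  have hst : Real.exp (-(α * δ * g.dist y y')) * g.len y ≤ L₀ * g.len y' := by
    have h1 : Real.exp (-(α * δ * g.dist y y')) * g.len y ^ (1 : ℝ) ≤ g.L ^ |(1 : ℝ)| * g.len y' ^ (1 : ℝ) := by
      have h := scaleTransfer_len_rpow hF 1 (by norm_num) y' y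
      rw [hG.symm y' y] at h
      exact h
    rw [Real.rpow_one, Real.rpow_one, rpow_abs_eq_pow g.L 1 1 (by norm_num), pow_one] at h1
    exact h1.trans (mul_le_mul_of_nonneg_right hF.L_le (hG.lenle y'))
  have hsplit : Real.exp (-(r * g.dist y y')) = Real.exp (-((r - α * δ) * g.dist y y')) * Real.exp (-(α * δ * g.dist y y')) := by
    rw [← Real.exp_add]; congr 1; ring
  have hE : 0 ≤ C * Real.exp (-((r - α * δ) * g.dist y y')) := mul_nonneg hC (Real.exp_nonneg _)
  have hs0 : 0 ≤ g.len y ^ s := Real.rpow_nonneg (hG.lenle y) s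
  calc g.len y ^ s * g.len y * N = g.len y * (g.len y ^ s * N) := by ring
    _ ≤ g.len y * (C * Real.exp (-(r * g.dist y y')) * (w y' * N')) := mul_le_mul_of_nonneg_left hb (hG.lenle y)
    _ = C * Real.exp (-((r - α * δ) * g.dist y y')) * (Real.exp (-(α * δ * g.dist y y')) * g.len y) * (w y' * N') := by
        rw [hsplit]; ring
    _ ≤ C * Real.exp (-((r - α * δ) * g.dist y y')) * (L₀ * g.len y') * (w y' * N') :=
        mul_le_mul_of_nonneg_right (mul_le_mul_of_nonneg_left hst hE) hwN
    _ = C * L₀ * Real.exp (-((r - α * δ) * g.dist y y')) * (g.len y' * w y' * N') := by ring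

/-! ## §1 The sup letters: G₀Q\*, E∘G₀∘Q\* -/

omit [Fintype V] [Fintype Z] [Fintype PX] in
/-- ★ **G₀Q\* : bZ → 𝔠⁽²⁾ (`LettersHZ.gQs2`, `Letters313Z.gQs2`) FROM (3.42)₁ FOR G₀ AND THE Q\*-LETTER**: G₀ : 𝔠⁽⁰⁾ → 𝔠⁽²⁾ (B₀e^{−δ₀d}, `Thm33G0.e0` ∕
`Conv3107`) after Q\* : bZ → 𝔠⁽⁰⁾ (B_Qe^{−δ_Qd}) has B₀B_Qc·e^{−δ₃d} for δ₃ ≦ δ₀, δ₃ + σ ≦ δ_Q (the row sum spent on Q\*; [4] (2.54)+(2.61)); any B₃ ≧ B₀B_Qc.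
[cite: Balaban1985BackgroundPropagators, Thm 3.3 (3.42) p.397 + (3.126) p.420 + (3.110) p.417; Balaban1984PropagatorsII, (2.52)–(2.56) pp.232–233 + Lemma 2.1 (2.61) p.234] -/
theorem gQs2_of_e0 (hG : GeoOK g) {σ c : ℝ} (hrow : RowSum (toB6 g R₀ H₀) σ c) {bZ : BlockNorm (toB6 g R₀ H₀) (Z → ℝ)}
    {blk : X → g.Site} {G0 : Module.End ℝ (X → ℝ)} {Qs : (Z → ℝ) →ₗ[ℝ] (X → ℝ)} {B₀ δ₀ BQ δQ B₃ δ₃ : ℝ}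
    (hB₀ : 0 ≤ B₀) (hBQ : 0 ≤ BQ) (hc : 0 ≤ c) (hδ₃ : 0 ≤ δ₃) (hδ₃0 : δ₃ ≤ δ₀) (hδ₃Q : δ₃ + σ ≤ δQ) (hB₃ : B₀ * BQ * c ≤ B₃)
    (he0 : HasMajorant (g := toB6 g R₀ H₀) blk G0 (fun (a b : g.Site) => B₀ * g.len a ^ 2 * Real.exp (-(δ₀ * g.dist a b))))
    (hqs : HasMaj bZ (cNorm R₀ H₀ blk hG.lenle 0) Qs (fun a b => BQ * Real.exp (-(δQ * g.dist a b)))) :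
    HasMaj bZ (cNorm R₀ H₀ blk hG.lenle 2) (G0 ∘ₗ Qs) (fun a b => B₃ * Real.exp (-(δ₃ * g.dist a b))) := by
  have htri : Triangle254 (toB6 g R₀ H₀) := fun a b c => hG.tri a b c
  have hsym : DistSymm (toB6 g R₀ H₀) := fun a b => hG.symm a b
  -- G₀ : 𝔠⁽⁰⁾ → 𝔠⁽²⁾
  have h0 : HasMaj (cNorm R₀ H₀ blk hG.lenle 0) (cNorm R₀ H₀ blk hG.lenle 2) G0 (fun a b => B₀ * Real.exp (-(δ₀ * g.dist a b))) := by
    have h := hasMaj_cls_of_hom hG 2 hB₀ (hasMajorantHom_mono (g := toB6 g R₀ H₀) blk blk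
      ((hasMajorantHom_iff (g := toB6 g R₀ H₀) blk G0 _).mpr he0) fun a b => le_of_eq (by rw [Real.rpow_two]))
    have h' : HasMaj (cNormR R₀ H₀ blk hG.lenle (-((0 : ℕ) : ℝ))) (cNormR R₀ H₀ blk hG.lenle (-((2 : ℕ) : ℝ))) G0
        (fun a b => B₀ * Real.exp (-(δ₀ * g.dist a b))) := by
      simpa only [Nat.cast_zero, neg_zero, Nat.cast_ofNat] using h
    exact hasMaj_ofR hG h'
  have hcomp := hasMaj_comp_exp_mirror hsym htri hG.dnn hrow hB₀ hBQ hδ₃ hδ₃0 hδ₃Q h0 hqs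
  refine (hasMaj_weaken hG (mul_nonneg (mul_nonneg hB₀ hBQ) hc) hB₃ le_rfl (hcomp.mono fun a b => le_of_eq ?_))
  simp only [cNorm_κ, toB6_dist]
  ring

omit [Fintype Z] [Fintype PX] in
/-- ★ **E∘G₀∘Q\* : bZ → 𝔠_V⁽¹⁾ FOR A FIRST-ORDER LEFT LETTER E** (E = ∇_U: `LettersHZ.dgQs`, `Letters313DZ.dgQs`; E = ∇_{U,ν}: `Letters313DMZ.dgQsd`):
E∘G₀ : 𝔠⁽⁰⁾ → 𝔠_V⁽¹⁾ (B₀e^{−δ₀d}; `LeftStep.e1` ∕ `Thm33G0Dir.e1d`, i.e. (3.42)₂ for G₀) after the Q\*-letter; constant B₀B_Qc, rate δ₃ ≦ δ₀ with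
δ₃ + σ ≦ δ_Q. [cite: Balaban1985BackgroundPropagators, Thm 3.3 (3.42) p.397 + (3.133) p.422 + (3.110) p.417; Balaban1984PropagatorsII, (2.52)–(2.56) pp.232–233 + Lemma 2.1 (2.61) p.234] -/
theorem dgQs_of_e1 (hG : GeoOK g) {σ c : ℝ} (hrow : RowSum (toB6 g R₀ H₀) σ c) {bZ : BlockNorm (toB6 g R₀ H₀) (Z → ℝ)}
    {blk : X → g.Site} {blkV : V → g.Site} {G0 : Module.End ℝ (X → ℝ)} {E : (X → ℝ) →ₗ[ℝ] (V → ℝ)} {Qs : (Z → ℝ) →ₗ[ℝ] (X → ℝ)}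
    {B₀ δ₀ BQ δQ B₃ δ₃ : ℝ}
    (hB₀ : 0 ≤ B₀) (hBQ : 0 ≤ BQ) (hc : 0 ≤ c) (hδ₃ : 0 ≤ δ₃) (hδ₃0 : δ₃ ≤ δ₀) (hδ₃Q : δ₃ + σ ≤ δQ) (hB₃ : B₀ * BQ * c ≤ B₃)
    (he1 : HasMajorantHom (g := toB6 g R₀ H₀) blk blkV (E ∘ₗ G0) (fun (a b : g.Site) => B₀ * g.len a * Real.exp (-(δ₀ * g.dist a b))))
    (hqs : HasMaj bZ (cNorm R₀ H₀ blk hG.lenle 0) Qs (fun a b => BQ * Real.exp (-(δQ * g.dist a b)))) :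
    HasMaj bZ (cNorm R₀ H₀ blkV hG.lenle 1) (E ∘ₗ G0 ∘ₗ Qs) (fun a b => B₃ * Real.exp (-(δ₃ * g.dist a b))) := by
  have htri : Triangle254 (toB6 g R₀ H₀) := fun a b c => hG.tri a b c
  have hsym : DistSymm (toB6 g R₀ H₀) := fun a b => hG.symm a b
  -- E∘G₀ : 𝔠⁽⁰⁾ → 𝔠_V⁽¹⁾
  have h1 : HasMaj (cNorm R₀ H₀ blk hG.lenle 0) (cNorm R₀ H₀ blkV hG.lenle 1) (E ∘ₗ G0) (fun a b => B₀ * Real.exp (-(δ₀ * g.dist a b))) := by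
    have h := hasMaj_cls_of_hom hG 1 hB₀ (hasMajorantHom_mono (g := toB6 g R₀ H₀) blk blkV he1 fun a b => le_of_eq (by rw [Real.rpow_one]))
    have h' : HasMaj (cNormR R₀ H₀ blk hG.lenle (-((0 : ℕ) : ℝ))) (cNormR R₀ H₀ blkV hG.lenle (-((1 : ℕ) : ℝ))) (E ∘ₗ G0)
        (fun a b => B₀ * Real.exp (-(δ₀ * g.dist a b))) := by
      simpa only [Nat.cast_zero, neg_zero, Nat.cast_one] using h
    exact hasMaj_ofR hG h'
  have hcomp := hasMaj_comp_exp_mirror hsym htri hG.dnn hrow hB₀ hBQ hδ₃ hδ₃0 hδ₃Q h1 hqs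
  refine (hasMaj_weaken hG (mul_nonneg (mul_nonneg hB₀ hBQ) hc) hB₃ le_rfl (hcomp.mono fun a b => le_of_eq ?_)).congr fun μ => rfl
  simp only [cNorm_κ, toB6_dist]
  ring

omit [Fintype V] [Fintype PX] in
/-- ★ **G₀Q\* : Z_{len·w} → 𝔠⁽¹⁾ (`Letters313Z.gQs1`)** — the letter `gQs2` with one power of the scale moved from the target to the source (p. 398's
transfer, `hasMaj_shift_weight`): constant B₀B_Qc·L₀, rate δ₃ ≦ δ₁ − αδ for the intermediate rate δ₁ ≦ δ₀, δ₁ + σ ≦ δ_Q; any B₃ ≧ B₀B_QcL₀.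
[cite: Balaban1985BackgroundPropagators, Thm 3.3 (3.42) p.397 + p.398 (remark after (3.47)) + (3.153) p.426; Balaban1984PropagatorsII, (2.52)–(2.56) pp.232–233 + Lemma 2.1 (2.60)–(2.61) p.234] -/
theorem gQs1_of_e0 (hG : GeoOK g) {dF : ℕ} {δ α L₀ σ c : ℝ} (hF : Facts347 g R₀ H₀ dF δ α L₀) (hrow : RowSum (toB6 g R₀ H₀) σ c)
    {blkZ : Z → g.Site} {w : g.Site → ℝ} (hw : ∀ y, 0 ≤ w y) (hw' : ∀ y, 0 ≤ g.len y * w y)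
    {blk : X → g.Site} {G0 : Module.End ℝ (X → ℝ)} {Qs : (Z → ℝ) →ₗ[ℝ] (X → ℝ)} {B₀ δ₀ BQ δQ δ₁ B₃ δ₃ : ℝ}
    (hB₀ : 0 ≤ B₀) (hBQ : 0 ≤ BQ) (hc : 0 ≤ c) (hδ₁ : 0 ≤ δ₁) (hδ₁0 : δ₁ ≤ δ₀) (hδ₁Q : δ₁ + σ ≤ δQ)
    (hB₃ : B₀ * BQ * c * L₀ ≤ B₃) (hδ₃ : δ₃ ≤ δ₁ - α * δ)
    (he0 : HasMajorant (g := toB6 g R₀ H₀) blk G0 (fun (a b : g.Site) => B₀ * g.len a ^ 2 * Real.exp (-(δ₀ * g.dist a b))))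
    (hqs : HasMaj (weightNorm (BlockNorm.ofBlocks (toB6 g R₀ H₀) blkZ) w hw) (cNorm R₀ H₀ blk hG.lenle 0) Qs
      (fun a b => BQ * Real.exp (-(δQ * g.dist a b)))) :
    HasMaj (weightNorm (BlockNorm.ofBlocks (toB6 g R₀ H₀) blkZ) (fun y => g.len y * w y) hw') (cNorm R₀ H₀ blk hG.lenle 1) (G0 ∘ₗ Qs)
      (fun a b => B₃ * Real.exp (-(δ₃ * g.dist a b))) := by
  have hK : 0 ≤ B₀ * BQ * c := mul_nonneg (mul_nonneg hB₀ hBQ) hc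
  have h2 := gQs2_of_e0 hG hrow hB₀ hBQ hc hδ₁ hδ₁0 hδ₁Q le_rfl he0 hqs
  -- to the real-weight class 𝔠^{(−2)}, shift by one power, back to `cNorm … 1`
  have h2R : HasMaj (weightNorm (BlockNorm.ofBlocks (toB6 g R₀ H₀) blkZ) w hw) (cNormR R₀ H₀ blk hG.lenle (-2)) (G0 ∘ₗ Qs)
      (fun a b => B₀ * BQ * c * Real.exp (-(δ₁ * g.dist a b))) := by
    intro y' μ hμ y
    have e : (cNormR R₀ H₀ blk hG.lenle (-2)).loc y ((G0 ∘ₗ Qs) μ) = (cNorm R₀ H₀ blk hG.lenle 2).loc y ((G0 ∘ₗ Qs) μ) := by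
      have h0 := cNormR_loc_neg_natCast (R₀ := R₀) (H₀ := H₀) hG blk 2 y ((G0 ∘ₗ Qs) μ)
      simpa only [Nat.cast_ofNat] using h0
    rw [e]
    exact h2 y' μ hμ y
  have h1R := hasMaj_shift_weight hG hF hw hw' hK h2R
  have h1R' : HasMaj (weightNorm (BlockNorm.ofBlocks (toB6 g R₀ H₀) blkZ) (fun y => g.len y * w y) hw') (cNormR R₀ H₀ blk hG.lenle (-((1 : ℕ) : ℝ)))
      (G0 ∘ₗ Qs) (fun a b => B₀ * BQ * c * L₀ * Real.exp (-((δ₁ - α * δ) * g.dist a b))) := by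
    refine fun y' μ hμ y => (h1R y' μ hμ y).trans_eq' ?_
    norm_num
  have hL₀ : 0 ≤ L₀ := le_trans (le_trans zero_le_one hF.one_le_L) hF.L_le
  have hw1 := hasMaj_weaken hG (mul_nonneg hK hL₀) hB₃ hδ₃ h1R'
  intro y' μ hμ y
  rw [← cNormR_loc_neg_natCast hG]
  exact hw1 y' μ hμ y

/-! ## §2 The Hölder-probe letters: Φ_β∘E∘G₀∘Q\*, Φ^X_β∘G₀∘Q\* -/

omit [Fintype V] [Fintype Z] in
/-- ★ **Φ_β∘E∘G₀∘Q\* : bZ → 𝔠_P^{(β−1)} FROM A (3.43)-SHAPE PROBE MAJORANT OF Φ_β∘E∘G₀** (`LettersHHZ.pQ` with E = ∇_U and `Thm33G0Dir.h43L`;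
`Letters313DMZ.pQd` with E = ∇_{U,ν} and `Thm33G0Dir.h43d`): the probe majorant B_h(β)(Lʲη)^{1−β}e^{−δ₀d} read as 𝔠⁽⁰⁾ → 𝔠_P^{(β−1)}
(`hasMaj_cls_of_hom`), then the Q\*-letter at the margin σ: constant B_h(β)B_Qc, rate δ₃ ≦ δ₀ with δ₃ + σ ≦ δ_Q; any B_q ≧ B_h(β)B_Qc.
[cite: Balaban1985BackgroundPropagators, (3.43) p.398 + (3.40) p.397 + (3.133) p.422 + (3.110) p.417; Balaban1984PropagatorsII, (2.52)–(2.56) pp.232–233 + Lemma 2.1 (2.61) p.234] -/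
theorem pQ_of_h43 (hG : GeoOK g) {σ c : ℝ} (hrow : RowSum (toB6 g R₀ H₀) σ c) {bZ : BlockNorm (toB6 g R₀ H₀) (Z → ℝ)}
    {blk : X → g.Site} {blkP : PX → g.Site} {T : (X → ℝ) →ₗ[ℝ] (PX → ℝ)} {Qs : (Z → ℝ) →ₗ[ℝ] (X → ℝ)} {β Bh δ₀ BQ δQ Bq δ₃ : ℝ}
    (hBh : 0 ≤ Bh) (hBQ : 0 ≤ BQ) (hc : 0 ≤ c) (hδ₃ : 0 ≤ δ₃) (hδ₃0 : δ₃ ≤ δ₀) (hδ₃Q : δ₃ + σ ≤ δQ) (hBq : Bh * BQ * c ≤ Bq)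
    (h43 : HasMajorantHom (g := toB6 g R₀ H₀) blk blkP T (fun (a b : g.Site) => Bh * g.len a ^ (1 - β) * Real.exp (-(δ₀ * g.dist a b))))
    (hqs : HasMaj bZ (cNorm R₀ H₀ blk hG.lenle 0) Qs (fun a b => BQ * Real.exp (-(δQ * g.dist a b)))) :
    HasMaj bZ (cNormR R₀ H₀ blkP hG.lenle (β - 1)) (T ∘ₗ Qs) (fun a b => Bq * Real.exp (-(δ₃ * g.dist a b))) := by
  have htri : Triangle254 (toB6 g R₀ H₀) := fun a b c => hG.tri a b c
  have hsym : DistSymm (toB6 g R₀ H₀) := fun a b => hG.symm a b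
  have hT := hasMaj_cls_of_hom hG (1 - β) hBh h43
  have e : -(1 - β) = β - 1 := by ring
  rw [e] at hT
  have hcomp := hasMaj_comp_exp_mirror hsym htri hG.dnn hrow hBh hBQ hδ₃ hδ₃0 hδ₃Q hT (hasMaj_toR_out0 hG hqs)
  refine hasMaj_weaken hG (mul_nonneg (mul_nonneg hBh hBQ) hc) hBq le_rfl (hcomp.mono fun a b => le_of_eq ?_)
  simp only [cNormR_κ, toB6_dist]
  ring

omit [Fintype V] in
/-- ★ **Φ^X_β∘G₀∘Q\* : Z_{len·w} → 𝔠_P^{(β−1)} (`Letters313HZ.pXQs`) FROM THE ZEROTH-ORDER PROBE OF G₀** (`Thm33G0DirX.pX0 β`: Φ^X_β∘G₀ : 𝔠⁽⁰⁾ →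
𝔠_P^{(β−2)}, B_x0(β)e^{−δ₀d}): the Q\*-letter at the margin σ (intermediate rate δ₁ ≦ δ₀, δ₁ + σ ≦ δ_Q), then one power of the scale moved from the
target to the source (`hasMaj_shift_weight`): constant B_x0(β)B_QcL₀, rate δ₃ ≦ δ₁ − αδ.
[cite: Balaban1985BackgroundPropagators, (3.43) p.398 + (3.40) p.397 + p.398 (remark after (3.47)) + (3.153) p.426; Balaban1984PropagatorsII, (2.52)–(2.56) pp.232–233 + Lemma 2.1 (2.60)–(2.61) p.234] -/
theorem pXQs_of_pX0 (hG : GeoOK g) {dF : ℕ} {δ α L₀ σ c : ℝ} (hF : Facts347 g R₀ H₀ dF δ α L₀) (hrow : RowSum (toB6 g R₀ H₀) σ c)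
    {blkZ : Z → g.Site} {w : g.Site → ℝ} (hw : ∀ y, 0 ≤ w y) (hw' : ∀ y, 0 ≤ g.len y * w y)
    {blk : X → g.Site} {blkP : PX → g.Site} {T : (X → ℝ) →ₗ[ℝ] (PX → ℝ)} {Qs : (Z → ℝ) →ₗ[ℝ] (X → ℝ)} {β Bx δ₀ BQ δQ δ₁ Bq δ₃ : ℝ}
    (hBx : 0 ≤ Bx) (hBQ : 0 ≤ BQ) (hc : 0 ≤ c) (hδ₁ : 0 ≤ δ₁) (hδ₁0 : δ₁ ≤ δ₀) (hδ₁Q : δ₁ + σ ≤ δQ)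
    (hBq : Bx * BQ * c * L₀ ≤ Bq) (hδ₃ : δ₃ ≤ δ₁ - α * δ)
    (hpX0 : HasMaj (cNormR R₀ H₀ blk hG.lenle 0) (cNormR R₀ H₀ blkP hG.lenle (β - 2)) T (fun a b => Bx * Real.exp (-(δ₀ * g.dist a b))))
    (hqs : HasMaj (weightNorm (BlockNorm.ofBlocks (toB6 g R₀ H₀) blkZ) w hw) (cNorm R₀ H₀ blk hG.lenle 0) Qs
      (fun a b => BQ * Real.exp (-(δQ * g.dist a b)))) :
    HasMaj (weightNorm (BlockNorm.ofBlocks (toB6 g R₀ H₀) blkZ) (fun y => g.len y * w y) hw') (cNormR R₀ H₀ blkP hG.lenle (β - 1)) (T ∘ₗ Qs)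
      (fun a b => Bq * Real.exp (-(δ₃ * g.dist a b))) := by
  have htri : Triangle254 (toB6 g R₀ H₀) := fun a b c => hG.tri a b c
  have hsym : DistSymm (toB6 g R₀ H₀) := fun a b => hG.symm a b
  have hK : 0 ≤ Bx * BQ * c := mul_nonneg (mul_nonneg hBx hBQ) hc
  have hcomp := hasMaj_comp_exp_mirror hsym htri hG.dnn hrow hBx hBQ hδ₁ hδ₁0 hδ₁Q hpX0 (hasMaj_toR_out0 hG hqs)
  have hcomp' : HasMaj (weightNorm (BlockNorm.ofBlocks (toB6 g R₀ H₀) blkZ) w hw) (cNormR R₀ H₀ blkP hG.lenle (β - 2)) (T ∘ₗ Qs)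
      (fun a b => Bx * BQ * c * Real.exp (-(δ₁ * g.dist a b))) := by
    refine hcomp.mono fun a b => le_of_eq ?_
    simp only [cNormR_κ, toB6_dist]
    ring
  have hsh := hasMaj_shift_weight hG hF hw hw' hK hcomp'
  have e : β - 2 + 1 = β - 1 := by ring
  rw [e] at hsh
  have hL₀ : 0 ≤ L₀ := le_trans (le_trans zero_le_one hF.one_le_L) hF.L_le
  exact hasMaj_weaken hG (mul_nonneg hK hL₀) hBq hδ₃ hsh

/-! ## §3 The block-L² letters: A∘Q\* from a (3.46)-line of A -/

section L2

omit [Fintype PX] in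
/-- ★ **A∘Q\* IN BLOCK-L² FROM A (3.46)-LINE OF A WITH INPUT SCALE L^{j″}η** — generic: if ‖1_{Δ(y)}Aμ‖₂ ≦ B₂·u(y)·L^{j″}η·e^{−δ₁d(y,y″)}‖μ‖₂ (u > 0 the
output weight: Lʲη for G₀, 1 for ∇G₀ ∕ ∇_νG₀, (Lʲη)⁻¹ for ∇_ν∇_μG₀) and Q\* has the block bound B_Q(L^{j″}η)⁻¹(v_Z·L^{j′}η)(y′)e^{−δ_Qd(y″,y′)}, then
‖1_{Δ(y)}AQ\*B‖₂ ≦ B₂B_Qc·u(y)·(v_Z·L^{j′}η)(y′)·e^{−ρd(y,y′)}‖B‖₂ for 0 ≦ ρ ≦ δ₁, ρ + σ ≦ δ_Q — one composition between the weighted block-L² spaces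
(`hasMaj_l2w_of_blockBd`, [4] (2.54)+(2.61) spent on Q\*, `blockBd_of_hasMaj_l2w`). [cite: Balaban1985BackgroundPropagators, (3.46) p.398 + (3.153) p.426 + (3.110) p.417; Balaban1984PropagatorsII, (2.52)–(2.56) pp.232–233 + Lemma 2.1 (2.61) p.234] -/
theorem blockBd_comp_qstar (hG : GeoOK g) {σ c : ℝ} (hrow : RowSum (toB6 g R₀ H₀) σ c) {blkZ : Z → g.Site} {blk : X → g.Site}
    {blkV : V → g.Site} {A : (X → ℝ) →ₗ[ℝ] (V → ℝ)} {Qs : (Z → ℝ) →ₗ[ℝ] (X → ℝ)} {u vZ : g.Site → ℝ} (hu : ∀ y, 0 < u y)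
    (hvZ : ∀ y, 0 ≤ vZ y) {B₂ δ₁ BQ δQ ρ : ℝ} (hB₂ : 0 ≤ B₂) (hBQ : 0 ≤ BQ) (hρ : 0 ≤ ρ) (hρ₁ : ρ ≤ δ₁) (hρQ : ρ + σ ≤ δQ)
    (hA : BlockBd (g := toB6 g R₀ H₀) blk blkV A (fun (y y' : g.Site) => B₂ * u y * g.len y' * Real.exp (-(δ₁ * g.dist y y'))))
    (hqsL2 : BlockBd (g := toB6 g R₀ H₀) blkZ blk Qs
      (fun (y y' : g.Site) => BQ * (g.len y)⁻¹ * (vZ y' * g.len y') * Real.exp (-(δQ * g.dist y y')))) :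
    BlockBd (g := toB6 g R₀ H₀) blkZ blkV (A ∘ₗ Qs)
      (fun (y y' : g.Site) => B₂ * BQ * c * u y * (vZ y' * g.len y') * Real.exp (-(ρ * g.dist y y'))) := by
  have htri : Triangle254 (toB6 g R₀ H₀) := fun a b c => hG.tri a b c
  have hsym : DistSymm (toB6 g R₀ H₀) := fun a b => hG.symm a b
  have hui : ∀ y, 0 ≤ (u y)⁻¹ := fun y => inv_nonneg.mpr (hu y).le
  have hvl : ∀ y, 0 ≤ vZ y * g.len y := fun y => mul_nonneg (hvZ y) (hG.lenle y)
  -- A : (block-L², weight L^{j″}η) → (block-L², weight u⁻¹)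
  have hA' : HasMaj (l2w (toB6 g R₀ H₀) blk (fun y => g.len y) hG.lenle) (l2w (toB6 g R₀ H₀) blkV (fun y => (u y)⁻¹) hui) A
      (fun a b => B₂ * Real.exp (-(δ₁ * g.dist a b))) :=
    hasMaj_l2w_of_blockBd (g := toB6 g R₀ H₀) hG.lenle hui hA fun y y' => le_of_eq (by
      show (u y)⁻¹ * (B₂ * u y * g.len y' * Real.exp (-(δ₁ * g.dist y y'))) = B₂ * Real.exp (-(δ₁ * g.dist y y')) * g.len y'
      have hu0 : u y ≠ 0 := (hu y).ne'
      calc (u y)⁻¹ * (B₂ * u y * g.len y' * Real.exp (-(δ₁ * g.dist y y')))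
          = ((u y)⁻¹ * u y) * (B₂ * Real.exp (-(δ₁ * g.dist y y')) * g.len y') := by ring
        _ = B₂ * Real.exp (-(δ₁ * g.dist y y')) * g.len y' := by rw [inv_mul_cancel₀ hu0, one_mul])
  -- Q* : (block-L², weight v_Z·L^{j′}η) → (block-L², weight L^{j″}η)
  have hQ' : HasMaj (l2w (toB6 g R₀ H₀) blkZ (fun y => vZ y * g.len y) hvl) (l2w (toB6 g R₀ H₀) blk (fun y => g.len y) hG.lenle) Qs
      (fun a b => BQ * Real.exp (-(δQ * g.dist a b))) :=
    hasMaj_l2w_of_blockBd (g := toB6 g R₀ H₀) hvl hG.lenle hqsL2 fun y y' => le_of_eq (by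
      show g.len y * (BQ * (g.len y)⁻¹ * (vZ y' * g.len y') * Real.exp (-(δQ * g.dist y y'))) =
        BQ * Real.exp (-(δQ * g.dist y y')) * (vZ y' * g.len y')
      have hl0 : g.len y ≠ 0 := (hG.lenpos y).ne'
      calc g.len y * (BQ * (g.len y)⁻¹ * (vZ y' * g.len y') * Real.exp (-(δQ * g.dist y y')))
          = (g.len y * (g.len y)⁻¹) * (BQ * Real.exp (-(δQ * g.dist y y')) * (vZ y' * g.len y')) := by ring
        _ = BQ * Real.exp (-(δQ * g.dist y y')) * (vZ y' * g.len y') := by rw [mul_inv_cancel₀ hl0, one_mul])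
  have hcomp := hasMaj_comp_exp_mirror hsym htri hG.dnn hrow hB₂ hBQ hρ hρ₁ hρQ hA' hQ'
  have hcomp' : HasMaj (l2w (toB6 g R₀ H₀) blkZ (fun y => vZ y * g.len y) hvl) (l2w (toB6 g R₀ H₀) blkV (fun y => (u y)⁻¹) hui) (A ∘ₗ Qs)
      (fun a b => B₂ * BQ * c * Real.exp (-(ρ * g.dist a b))) := by
    refine hcomp.mono fun a b => le_of_eq ?_
    simp only [l2w_κ, toB6_dist]
    ring
  refine (blockBd_of_hasMaj_l2w (g := toB6 g R₀ H₀) hcomp' fun y => inv_pos.mpr (hu y)).mono fun y y' => le_of_eq ?_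
  show B₂ * BQ * c * Real.exp (-(ρ * g.dist y y')) * (vZ y' * g.len y') / (u y)⁻¹ =
    B₂ * BQ * c * u y * (vZ y' * g.len y') * Real.exp (-(ρ * g.dist y y'))
  rw [div_inv_eq_mul]
  ring

omit [Fintype V] [Fintype PX] in
/-- ★ **G₀Q\* IN BLOCK-L² (`Letters313L2PZ.gQs`)** from the symmetrised (3.46)₀-line of G₀ (`Thm33G0L2P.l0`: B₂·Lʲη·L^{j″}η·e^{−δ₁d}) and the L²
Q\*-letter: ‖1_{Δ(y)}G₀Q\*B‖₂ ≦ B₄·Lʲη·(v_Z·L^{j′}η)(y′)·e^{−ρd(y,y′)}‖B‖₂ for any B₄ ≧ B₂B_Qc, 0 ≦ ρ ≦ δ₁, ρ + σ ≦ δ_Q.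
[cite: Balaban1985BackgroundPropagators, (3.46) p.398 + (3.153) p.426; Balaban1984PropagatorsII, (2.52)–(2.56) pp.232–233 + Lemma 2.1 (2.61) p.234] -/
theorem gQs_l2_of_l0 (hG : GeoOK g) {σ c : ℝ} (hrow : RowSum (toB6 g R₀ H₀) σ c) {blkZ : Z → g.Site} {blk : X → g.Site}
    {G0 : Module.End ℝ (X → ℝ)} {Qs : (Z → ℝ) →ₗ[ℝ] (X → ℝ)} {vZ : g.Site → ℝ} (hvZ : ∀ y, 0 ≤ vZ y) {B₂ δ₁ BQ δQ ρ B₄ : ℝ}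
    (hB₂ : 0 ≤ B₂) (hBQ : 0 ≤ BQ) (hρ : 0 ≤ ρ) (hρ₁ : ρ ≤ δ₁) (hρQ : ρ + σ ≤ δQ) (hB₄ : B₂ * BQ * c ≤ B₄)
    (hl0 : BlockBd (g := toB6 g R₀ H₀) blk blk G0 (fun (y y' : g.Site) => B₂ * g.len y * g.len y' * Real.exp (-(δ₁ * g.dist y y'))))
    (hqsL2 : BlockBd (g := toB6 g R₀ H₀) blkZ blk Qs
      (fun (y y' : g.Site) => BQ * (g.len y)⁻¹ * (vZ y' * g.len y') * Real.exp (-(δQ * g.dist y y')))) :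
    BlockBd (g := toB6 g R₀ H₀) blkZ blk (G0 ∘ₗ Qs)
      (fun (y y' : g.Site) => B₄ * g.len y * (vZ y' * g.len y') * Real.exp (-(ρ * g.dist y y'))) := by
  have h := blockBd_comp_qstar hG hrow (u := fun y => g.len y) hG.lenpos hvZ hB₂ hBQ hρ hρ₁ hρQ hl0 hqsL2
  refine h.mono fun y y' => ?_
  have hw : 0 ≤ g.len y * (vZ y' * g.len y') * Real.exp (-(ρ * g.dist y y')) :=
    mul_nonneg (mul_nonneg (hG.lenle y) (mul_nonneg (hvZ y') (hG.lenle y'))) (Real.exp_nonneg _)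
  calc B₂ * BQ * c * g.len y * (vZ y' * g.len y') * Real.exp (-(ρ * g.dist y y'))
      = B₂ * BQ * c * (g.len y * (vZ y' * g.len y') * Real.exp (-(ρ * g.dist y y'))) := by ring
    _ ≤ B₄ * (g.len y * (vZ y' * g.len y') * Real.exp (-(ρ * g.dist y y'))) := mul_le_mul_of_nonneg_right hB₄ hw
    _ = B₄ * g.len y * (vZ y' * g.len y') * Real.exp (-(ρ * g.dist y y')) := by ring

omit [Fintype PX] in
/-- ★ **E∘G₀∘Q\* IN BLOCK-L² FOR A FIRST-ORDER LEFT LETTER E** (`Letters313L2PZ.dGQs` with E = ∇_U and `Thm33G0L2P.l1`; `Letters313L2MZ.dGQsd ν` with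
E = ∇_{U,ν} and `Thm33G0L2M.l1d`): from ‖1_{Δ(y)}EG₀μ‖₂ ≦ B₂·L^{j″}η·e^{−δ₁d}‖μ‖₂ and the L² Q\*-letter, ‖1_{Δ(y)}EG₀Q\*B‖₂ ≦ B₄·(v_Z·L^{j′}η)(y′)·
e^{−ρd(y,y′)}‖B‖₂ for B₄ ≧ B₂B_Qc, 0 ≦ ρ ≦ δ₁, ρ + σ ≦ δ_Q. [cite: Balaban1985BackgroundPropagators, (3.46) p.398 + (3.153) p.426; Balaban1984PropagatorsII, (2.52)–(2.56) pp.232–233 + Lemma 2.1 (2.61) p.234] -/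
theorem dGQs_l2_of_l1 (hG : GeoOK g) {σ c : ℝ} (hrow : RowSum (toB6 g R₀ H₀) σ c) {blkZ : Z → g.Site} {blk : X → g.Site}
    {blkV : V → g.Site} {G0 : Module.End ℝ (X → ℝ)} {E : (X → ℝ) →ₗ[ℝ] (V → ℝ)} {Qs : (Z → ℝ) →ₗ[ℝ] (X → ℝ)} {vZ : g.Site → ℝ}
    (hvZ : ∀ y, 0 ≤ vZ y) {B₂ δ₁ BQ δQ ρ B₄ : ℝ}
    (hB₂ : 0 ≤ B₂) (hBQ : 0 ≤ BQ) (hρ : 0 ≤ ρ) (hρ₁ : ρ ≤ δ₁) (hρQ : ρ + σ ≤ δQ) (hB₄ : B₂ * BQ * c ≤ B₄)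
    (hl1 : BlockBd (g := toB6 g R₀ H₀) blk blkV (E ∘ₗ G0) (fun (y y' : g.Site) => B₂ * g.len y' * Real.exp (-(δ₁ * g.dist y y'))))
    (hqsL2 : BlockBd (g := toB6 g R₀ H₀) blkZ blk Qs
      (fun (y y' : g.Site) => BQ * (g.len y)⁻¹ * (vZ y' * g.len y') * Real.exp (-(δQ * g.dist y y')))) :
    BlockBd (g := toB6 g R₀ H₀) blkZ blkV (E ∘ₗ G0 ∘ₗ Qs)
      (fun (y y' : g.Site) => B₄ * (vZ y' * g.len y') * Real.exp (-(ρ * g.dist y y'))) := by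
  have hl1' : BlockBd (g := toB6 g R₀ H₀) blk blkV (E ∘ₗ G0)
      (fun (y y' : g.Site) => B₂ * (1 : ℝ) * g.len y' * Real.exp (-(δ₁ * g.dist y y'))) :=
    hl1.mono fun y y' => le_of_eq (by rw [mul_one])
  have h := blockBd_comp_qstar hG hrow (u := fun _ => (1 : ℝ)) (fun _ => one_pos) hvZ hB₂ hBQ hρ hρ₁ hρQ hl1' hqsL2
  have h' : BlockBd (g := toB6 g R₀ H₀) blkZ blkV (E ∘ₗ G0 ∘ₗ Qs)
      (fun (y y' : g.Site) => B₂ * BQ * c * (1 : ℝ) * (vZ y' * g.len y') * Real.exp (-(ρ * g.dist y y'))) :=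
    fun y' μ hμ y => h y' μ hμ y
  refine h'.mono fun y y' => ?_
  have hw : 0 ≤ (vZ y' * g.len y') * Real.exp (-(ρ * g.dist y y')) := mul_nonneg (mul_nonneg (hvZ y') (hG.lenle y')) (Real.exp_nonneg _)
  calc B₂ * BQ * c * 1 * (vZ y' * g.len y') * Real.exp (-(ρ * g.dist y y'))
      = B₂ * BQ * c * ((vZ y' * g.len y') * Real.exp (-(ρ * g.dist y y'))) := by ring
    _ ≤ B₄ * ((vZ y' * g.len y') * Real.exp (-(ρ * g.dist y y'))) := mul_le_mul_of_nonneg_right hB₄ hw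
    _ = B₄ * (vZ y' * g.len y') * Real.exp (-(ρ * g.dist y y')) := by ring

omit [Fintype PX] in
/-- ★ **E₂∘G₀∘Q\* IN BLOCK-L² FOR A SECOND-ORDER LEFT LETTER E₂** (`Letters313L2PZ.ddGQs q` with E₂ = ∇_{U,ν}∇_{U,μ} and `Thm33G0L2P.l3 q`: output weight
(Lʲη)⁻¹): ‖1_{Δ(y)}E₂G₀Q\*B‖₂ ≦ B₄·(Lʲη)⁻¹·(v_Z·L^{j′}η)(y′)·e^{−ρd(y,y′)}‖B‖₂ for B₄ ≧ B₂B_Qc, 0 ≦ ρ ≦ δ₁, ρ + σ ≦ δ_Q.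
[cite: Balaban1985BackgroundPropagators, (3.46) p.398 + (3.153) p.426; Balaban1984PropagatorsII, (2.52)–(2.56) pp.232–233 + Lemma 2.1 (2.61) p.234] -/
theorem ddGQs_l2_of_l3 (hG : GeoOK g) {σ c : ℝ} (hrow : RowSum (toB6 g R₀ H₀) σ c) {blkZ : Z → g.Site} {blk : X → g.Site}
    {blkV : V → g.Site} {G0 : Module.End ℝ (X → ℝ)} {E₂ : (X → ℝ) →ₗ[ℝ] (V → ℝ)} {Qs : (Z → ℝ) →ₗ[ℝ] (X → ℝ)} {vZ : g.Site → ℝ}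
    (hvZ : ∀ y, 0 ≤ vZ y) {B₂ δ₁ BQ δQ ρ B₄ : ℝ}
    (hB₂ : 0 ≤ B₂) (hBQ : 0 ≤ BQ) (hρ : 0 ≤ ρ) (hρ₁ : ρ ≤ δ₁) (hρQ : ρ + σ ≤ δQ) (hB₄ : B₂ * BQ * c ≤ B₄)
    (hl3 : BlockBd (g := toB6 g R₀ H₀) blk blkV (E₂ ∘ₗ G0)
      (fun (y y' : g.Site) => B₂ * ((g.len y)⁻¹ * g.len y') * Real.exp (-(δ₁ * g.dist y y'))))
    (hqsL2 : BlockBd (g := toB6 g R₀ H₀) blkZ blk Qs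
      (fun (y y' : g.Site) => BQ * (g.len y)⁻¹ * (vZ y' * g.len y') * Real.exp (-(δQ * g.dist y y')))) :
    BlockBd (g := toB6 g R₀ H₀) blkZ blkV (E₂ ∘ₗ G0 ∘ₗ Qs)
      (fun (y y' : g.Site) => B₄ * ((g.len y)⁻¹ * (vZ y' * g.len y')) * Real.exp (-(ρ * g.dist y y'))) := by
  have hl3' : BlockBd (g := toB6 g R₀ H₀) blk blkV (E₂ ∘ₗ G0)
      (fun (y y' : g.Site) => B₂ * (g.len y)⁻¹ * g.len y' * Real.exp (-(δ₁ * g.dist y y'))) :=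
    hl3.mono fun y y' => le_of_eq (by ring)
  have h := blockBd_comp_qstar hG hrow (u := fun y => (g.len y)⁻¹) (fun y => inv_pos.mpr (hG.lenpos y)) hvZ hB₂ hBQ hρ hρ₁ hρQ hl3' hqsL2
  have h' : BlockBd (g := toB6 g R₀ H₀) blkZ blkV (E₂ ∘ₗ G0 ∘ₗ Qs)
      (fun (y y' : g.Site) => B₂ * BQ * c * (g.len y)⁻¹ * (vZ y' * g.len y') * Real.exp (-(ρ * g.dist y y'))) :=
    fun y' μ hμ y => h y' μ hμ y
  refine h'.mono fun y y' => ?_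
  have hw : 0 ≤ (g.len y)⁻¹ * (vZ y' * g.len y') * Real.exp (-(ρ * g.dist y y')) :=
    mul_nonneg (mul_nonneg (inv_nonneg.mpr (hG.lenle y)) (mul_nonneg (hvZ y') (hG.lenle y'))) (Real.exp_nonneg _)
  calc B₂ * BQ * c * (g.len y)⁻¹ * (vZ y' * g.len y') * Real.exp (-(ρ * g.dist y y'))
      = B₂ * BQ * c * ((g.len y)⁻¹ * (vZ y' * g.len y') * Real.exp (-(ρ * g.dist y y'))) := by ring
    _ ≤ B₄ * ((g.len y)⁻¹ * (vZ y' * g.len y') * Real.exp (-(ρ * g.dist y y'))) := mul_le_mul_of_nonneg_right hB₄ hw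
    _ = B₄ * ((g.len y)⁻¹ * (vZ y' * g.len y')) * Real.exp (-(ρ * g.dist y y')) := by ring

end L2

end

end Literature.MathematicalPhysics.QuantumFieldTheory.Balaban1983to89.B9Thm313WholeQstarFromG0
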